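import Literature.AlgebraicGeometry.HodgeTheory.ComplexTorusIntegrationFamilyNormalised
import Literature.Geometry.Kaehler.ManifoldFormsPullback
import Literature.AlgebraicTopology.SingularHomology.IntegralClassRingChange
import HarnessLib

/-!
# The integral comparison of complex tori is functorial under ALL homomorphisms: `Hᵏ(f) = ⋀ᵏ ᵗρᵣ(f)`

Layer `Literature/AlgebraicGeometry/HodgeTheory`, namespace `Literature.AlgebraicGeometry.HodgeTheory`;
lane `lit-hodgefound`, programme row Q176 (A1-07⁺), sequel of
`ComplexTorusIntegrationFamilyNormalised.lean` (`e₀,X[normalisedComparison Φ k x] = x ⊗ 1` for the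
complexified integration family `e₀ = (integrationDeRhamIsoFamily E).complexify`).

Source. H. Lange, *Abelian Varieties over the Complex Numbers* (2023) [Lange2023AbelianVarietiesComplex],
§1.1.3 [p0023]: Lemma 1.1.17 "the canonical isomorphism `H¹(X, ℤ) → Hom(Λ, ℤ)`", "`Hⁿ(X, ℤ) ≅ Altⁿ(Λ, ℤ)`"
— canonical, hence compatible with homomorphisms `f : X → X'` via the rational representation
`ρᵣ(f) = ρₐ(f)|_Λ` (§1.1.2, "the restriction of `ρₐ(f)` to the lattice is `ℤ`-linear and determines `f`");
Lange–Birkenhake (1992) [LangeBirkenhake1992], §1.2 eq. (1.2): `H¹(f) = ᵗρᵣ(f)` on `H¹(X', ℤ) = Hom(Λ', ℤ)`.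

`ComplexTorusRationalClassesComparison.lean` (`normalisedComparison_map_torusMap`) proved the
compatibility of the lane's normalised comparison `Hᵏ((ℝ/ℤ)ⁿ; ℤ) → Alt^k_ℝ(E; ℂ)` with the
ENDOMORPHISMS `f_A`, `A ∈ Mₙ(ℤ)`, of ONE torus, by elementary matrices. With `g = 1` for the de Rham
isomorphism of record, which is natural for `C^∞` maps between manifolds charted on DIFFERENT model
spaces (`integrationDeRhamIsoFamily_complexify_natural₂`), the compatibility extends to every
homomorphism `f_A : E/Φ(ℤⁿ) → E'/Φ'(ℤᵐ)`, `A ∈ M(m × n, ℤ)` — isogenies, projections onto factors,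
embeddings of sub-tori, `X → X̂`:

* §0 `normalisedComparison_eq_iff` — **characterisation**: `normalisedComparison Φ k x` is THE invariant
  form whose `e₀`-class is `x ⊗ 1` (so the lane's comparison, defined by `ξ_s ↦ dx_s`, is the restriction
  to `Hᵏ(X; ℤ)` of the inverse of the de Rham isomorphism of record);
* §1 `cmap_cconstClass_mapMatrix_twoModels`, `complexify_cconstClass_comp_realRep_twoModels` —
  `f_A^*[ω_c] = [ω_{c ∘ ρ(A)}]` and `e₀,X[c ∘ ρ(A)] = f_A^* e₀,X'[c]` across model spaces;
* §2 **`normalisedComparison_map_torusMap_twoModels`** —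
  `normalisedComparison Φ k (f_A^* x) = (normalisedComparison Φ' k x) ∘ ρ(A)` for every
  `A ∈ M(m × n, ℤ)` and `x ∈ Hᵏ((ℝ/ℤ)ᵐ; ℤ)`: **`Hᵏ(f_A; ℤ)` is `⋀ᵏ` of the transpose of the rational
  representation** on the lattice monomials (`dx'_w ∘ ρ(A)`).

Theorems only; no definition, no named fact.

## References

* [Lange2023AbelianVarietiesComplex] H. Lange, *Abelian Varieties over the Complex Numbers* (2023),
  §1.1.2, §1.1.3 Lemma 1.1.17, §1.1.4 Prop. 1.1.20.
* [LangeBirkenhake1992] H. Lange, Ch. Birkenhake, *Complex Abelian Varieties* (1992), §1.1.2, §1.2 (1.2).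
* [HatcherAT2002] A. Hatcher, *Algebraic Topology* (2002), §3.1 p. 198 (change of coefficients is natural).
-/

noncomputable section

-- `ComplexTorus Φ` (for `Φ : ℝⁿ ≃ E`) is the type `Torus n = (ℝ/ℤ)ⁿ`; instance paths up to unfolding
set_option backward.isDefEq.respectTransparency false

open scoped Manifold ContDiff
open Literature.NumberTheory.Transcendental Literature.Geometry.Kaehler
open Literature.AlgebraicTopology.SingularHomology

namespace Literature.AlgebraicGeometry.HodgeTheory

/-! ### §0 The normalised comparison is characterised by the family of record -/

section Characterisation

variable {n : ℕ} {E : Type} [NormedAddCommGroup E] [NormedSpace ℂ E] [FiniteDimensional ℝ E]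
  (Φ : (Fin n → ℝ) ≃L[ℝ] E) {k : ℕ}

/-- **`normalisedComparison Φ k x` is THE invariant form whose `e₀`-class is `x ⊗ 1`**: for
`x ∈ Hᵏ((ℝ/ℤ)ⁿ; ℤ)` and an invariant form `γ`, `normalisedComparison Φ k x = γ ↔ e₀,X[γ] = x ⊗ 1`
(`γ ↦ e₀,X[γ]` is injective, `injective_apply_cconstClass`). The lane's comparison of
`ComplexTorusIntegralComparison.lean` (defined by `ξ_s ↦ dx_s`) is therefore the restriction to `Hᵏ(X; ℤ)`
of the inverse of the de Rham isomorphism of record — Lange's identification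
`Hⁿ(X, ℤ) ⊂ Hⁿ(X, ℂ) = Altⁿ_ℝ(V, ℂ)` "under the de Rham isomorphism".
[cite: Lange2023AbelianVarietiesComplex, §1.1.3 Lemma 1.1.17 and §1.1.4 Prop. 1.1.20] -/
theorem normalisedComparison_eq_iff (x : singularCohomology ℤ ℤ (Torus n) k) (γ : E [⋀^Fin k]→L[ℝ] ℂ) :
    ComplexTorus.normalisedComparison Φ k x = γ ↔
      (integrationDeRhamIsoFamily E).complexify (ComplexTorus Φ) k (ComplexTorus.cconstClass Φ γ) =
        singularCohomology.ringChange (Int.castRingHom ℂ) (Torus n) k x := by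
  constructor
  · rintro rfl
    exact complexify_cconstClass_normalisedComparison Φ x
  · intro h
    exact injective_apply_cconstClass Φ ((integrationDeRhamIsoFamily E).complexify)
      ((complexify_cconstClass_normalisedComparison Φ x).trans h.symm)

/-- **`e₀,X[γ] = x ⊗ 1` iff `γ = normalisedComparison Φ k x`.**
[cite: Lange2023AbelianVarietiesComplex, §1.1.3 Lemma 1.1.17 and §1.1.4 Prop. 1.1.20] -/
theorem complexify_cconstClass_eq_ringChange_iff (x : singularCohomology ℤ ℤ (Torus n) k)
    (γ : E [⋀^Fin k]→L[ℝ] ℂ) :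
    (integrationDeRhamIsoFamily E).complexify (ComplexTorus Φ) k (ComplexTorus.cconstClass Φ γ) =
        singularCohomology.ringChange (Int.castRingHom ℂ) (Torus n) k x ↔
      γ = ComplexTorus.normalisedComparison Φ k x := by
  rw [eq_comm (a := γ), normalisedComparison_eq_iff]

end Characterisation

/-! ### §1 Pull-back of invariant classes along homomorphisms between tori on two model spaces -/

section TwoModels

variable {ι ι' : Type} [Fintype ι] [Fintype ι'] {E E' : Type} [NormedAddCommGroup E] [NormedSpace ℂ E]
  [NormedAddCommGroup E'] [NormedSpace ℂ E'] [FiniteDimensional ℝ E] [FiniteDimensional ℝ E']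
  (Φ : (ι → ℝ) ≃L[ℝ] E) (Φ' : (ι' → ℝ) ≃L[ℝ] E') {k : ℕ}

omit [FiniteDimensional ℝ E] [FiniteDimensional ℝ E'] in
/-- **`f_A^*[ω_c] = [ω_{c ∘ ρ(A)}]`** for the homomorphism `f_A = mapMatrix A : E/Φ(ℤ^ι) → E'/Φ'(ℤ^ι')`
of an integer matrix `A ∈ M(ι' × ι, ℤ)` between tori on two model spaces (`ρ(A) = Φ' A_ℝ Φ⁻¹ : E → E'`
its real analytic representation; the one-model case is `ComplexTorus.cmap_cconstClass_mapMatrix₂`).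
[cite: LangeBirkenhake1992, §1.1.2 and §1.1.4] -/
theorem cmap_cconstClass_mapMatrix_twoModels (A : Matrix ι' ι ℤ) (c : E' [⋀^Fin k]→L[ℝ] ℂ) :
    complexDeRhamCohomology.map E
        (ComplexTorus.contMDiff_real_mapMatrix (Φ := Φ) (Φ' := Φ') (n := ∞) A) k
        (ComplexTorus.cconstClass Φ' c) =
      ComplexTorus.cconstClass Φ (c.compContinuousLinearMap (ComplexTorus.realRep Φ Φ' A)) := by
  rw [ComplexTorus.cconstClass_apply, complexDeRhamCohomology.map_mk, ComplexTorus.cconstClass_apply]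
  congr 1
  exact Subtype.ext (ComplexTorus.pullback_constForm_mapMatrix (Φ := Φ) (Φ' := Φ') A c)

/-- **`e₀,X[c ∘ ρ(A)] = f_A^* e₀,X'[c]`**: the complexified integration families of the two model spaces
intertwine pull-back of invariant forms with pull-back in singular cohomology along every homomorphism
`f_A` (naturality of the de Rham isomorphism for `C^∞` maps between manifolds of different dimensions,
`integrationDeRhamIsoFamily_complexify_natural₂`). [cite: LangeBirkenhake1992, §1.1.2 and §1.1.4] -/
theorem complexify_cconstClass_comp_realRep_twoModels (A : Matrix ι' ι ℤ) (c : E' [⋀^Fin k]→L[ℝ] ℂ) :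
    (integrationDeRhamIsoFamily E).complexify (ComplexTorus Φ) k
        (ComplexTorus.cconstClass Φ (c.compContinuousLinearMap (ComplexTorus.realRep Φ Φ' A))) =
      singularCohomology.map ℂ ℂ
        ⟨ComplexTorus.mapMatrix Φ Φ' A,
          (ComplexTorus.contMDiff_real_mapMatrix (Φ := Φ) (Φ' := Φ') (n := ∞) A).continuous⟩ k
        ((integrationDeRhamIsoFamily E').complexify (ComplexTorus Φ') k (ComplexTorus.cconstClass Φ' c)) := by
  haveI : FiniteDimensional ℂ E := Module.Finite.of_restrictScalars_finite ℝ ℂ E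
  haveI : FiniteDimensional ℂ E' := Module.Finite.of_restrictScalars_finite ℝ ℂ E'
  rw [← cmap_cconstClass_mapMatrix_twoModels Φ Φ' A c]
  exact integrationDeRhamIsoFamily_complexify_natural₂
    (ComplexTorus.contMDiff_real_mapMatrix (Φ := Φ) (Φ' := Φ') (n := ∞) A) k _

end TwoModels

/-! ### §2 `Hᵏ(f_A; ℤ) = ⋀ᵏ ᵗρᵣ(f_A)`: functoriality of the normalised comparison -/

section Functorial

variable {n m : ℕ} {E E' : Type} [NormedAddCommGroup E] [NormedSpace ℂ E]
  [NormedAddCommGroup E'] [NormedSpace ℂ E'] [FiniteDimensional ℝ E] [FiniteDimensional ℝ E']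
  (Φ : (Fin n → ℝ) ≃L[ℝ] E) (Φ' : (Fin m → ℝ) ≃L[ℝ] E') {k : ℕ}

omit [FiniteDimensional ℝ E] [FiniteDimensional ℝ E'] in
/-- The homomorphism `mapMatrix A : E/Φ(ℤⁿ) → E'/Φ'(ℤᵐ)` IS the torus map `f_A : (ℝ/ℤ)ⁿ → (ℝ/ℤ)ᵐ`
(same spaces, same formula `(f_A x)ᵢ = Σⱼ Aᵢⱼ xⱼ`; the square one-model case is
`continuousMap_mapMatrix_eq_torusMap`). [cite: LangeBirkenhake1992, §1.1.2] -/
theorem continuousMap_mapMatrix_eq_torusMap_twoModels (A : Matrix (Fin m) (Fin n) ℤ) :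
    (⟨ComplexTorus.mapMatrix Φ Φ' A,
        (ComplexTorus.contMDiff_real_mapMatrix (Φ := Φ) (Φ' := Φ') (n := ∞) A).continuous⟩ :
        C(ComplexTorus Φ, ComplexTorus Φ')) = torusMap A :=
  ContinuousMap.ext fun _ ↦ rfl

/-- **`Hᵏ(f_A; ℤ) = ⋀ᵏ ᵗρᵣ(f_A)`**: for every integer matrix `A ∈ M(m × n, ℤ)` — every homomorphism
`f_A : E/Φ(ℤⁿ) → E'/Φ'(ℤᵐ)` of complex tori, of any dimensions — and every `x ∈ Hᵏ((ℝ/ℤ)ᵐ; ℤ)`,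
`normalisedComparison Φ k (f_A^* x) = (normalisedComparison Φ' k x) ∘ ρ(A)`: under the identifications
`Hᵏ(X; ℤ) ≅ Hᵏ(X, ℤ) ⊂ Altᵏ_ℝ(E; ℂ)` of the two tori the pull-back `f_A^*` is precomposition with the
analytic representation (Lange–Birkenhake §1.2 (1.2): `H¹(f) = ᵗρᵣ(f)`, and `Hⁿ = ⋀ⁿ H¹`). Proof: both
sides have `e₀`-class `(f_A^* x) ⊗ 1` (§0, §1, `ringChange_map`).
[cite: LangeBirkenhake1992, §1.2 eq. (1.2)] [cite: Lange2023AbelianVarietiesComplex, §1.1.3 Lemma 1.1.17] -/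
theorem normalisedComparison_map_torusMap_twoModels (A : Matrix (Fin m) (Fin n) ℤ)
    (x : singularCohomology ℤ ℤ (Torus m) k) :
    ComplexTorus.normalisedComparison Φ k (singularCohomology.map ℤ ℤ (torusMap A) k x) =
      (ComplexTorus.normalisedComparison Φ' k x).compContinuousLinearMap (ComplexTorus.realRep Φ Φ' A) := by
  rw [normalisedComparison_eq_iff Φ, complexify_cconstClass_comp_realRep_twoModels,
    complexify_cconstClass_normalisedComparison, continuousMap_mapMatrix_eq_torusMap_twoModels,
    singularCohomology.ringChange_map]
  rfl

/-- The same on the lattice monomials: `f_A^* ξ'_w ↦ dx'_w ∘ ρ(A)` for every word `w`.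
[cite: LangeBirkenhake1992, §1.2 eq. (1.2)] -/
theorem normalisedComparison_map_torusMap_torusMonomial_twoModels (A : Matrix (Fin m) (Fin n) ℤ)
    (w : Fin k → Fin m) :
    ComplexTorus.normalisedComparison Φ k
        (singularCohomology.map ℤ ℤ (torusMap A) k (torusMonomial ℤ m k w)) =
      (ComplexTorus.latMonomial Φ' k w).compContinuousLinearMap (ComplexTorus.realRep Φ Φ' A) := by
  have hx : ComplexTorus.normalisedComparison Φ' k (torusMonomial ℤ m k w) = ComplexTorus.latMonomial Φ' k w := by
    rw [normalisedComparison_eq_iff Φ', complexify_cconstClass_latMonomial, ringChange_torusMonomial]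
  rw [normalisedComparison_map_torusMap_twoModels Φ Φ' A, hx]

end Functorial

end Literature.AlgebraicGeometry.HodgeTheory

end
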